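import Summits.Ventures.YMGap.YM4Door.DecimationFlow
import Summits.QuantumFields.YangMills.Theorems.Y2BridgeWindow
import Summits.QuantumFields.YangMills.Cruxes.IR.Lines.birth
import Summits.Ventures.YMGap.YM4Door.DecimationPush
import Literature.MathematicalPhysics.QuantumLattice.BalabanBlockAverage
import Literature.MathematicalPhysics.QuantumFieldTheory.TorusLoopLinkRP

/-!
# CruxIdea6Chain — «RG bridge strong→weak as a FINITE CERTIFIED CHAIN of decimation cells» (S-material, seat ym-cruxidea-19354-6)

TREE EDITION (g5, 2026-08-27) of the seat's desk `Sketch.lean` v3 (sha16 1e954e6e28cd6664, evidence on stmt-QuantumFields-19354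
2026-08-26T23:27:07Z), published under `Cruxes/IR/` per the route owner's READING-19354-g23 R10 (ii) («its S-material … 0 sorry … MAY be
landed … under `Cruxes/IR/` as window bookkeeping — welcome, LOW priority, not wanted»).  STATUS OF RECORD: lens −6 is WITHDRAWN as a
concluding line for `IR` (tree `Cruxes/IR/CENSUS-cruxidea6-crossover.md`, the BC9 ladder-ceiling evidence of record for computer-assisted
lines on this crux).  THIS MODULE IS NOT A LINE: no `stub_*`, no registration, nothing here is served to provers; it is importable
bookkeeping (cells / chains / kernel compositions / the exact axial loop identity) for whoever types a certificate FORMAT later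
(e.g. ym-instrument S2-SPEC v0.4 sets its option (β) := the `k = 0` instance of `FiniteTorusEnclosure` below).  0 `sorry`.

Crux `Summit.QuantumFields.YangMills.Theses.BalabanLadder.IR` (stmt-QuantumFields-19354), lens (director-ym R136 (ii)):
a finite, computer-assisted chain of block-spin (axial decimation) steps from the weak-coupling exit cell to the tree's
certified strong-coupling door `AtDoorCell (1/6; 11/500, 11/1000)`.  SIGNATURES ONLY (+ kernel glue that is pure
bookkeeping).  Nothing here is an estimate; every `def … : Prop` below is a REQUEST / certificate shape, not a claim.

* §1 (card `decimation-cell-chain`)  `Cell`, `CellDecimatesToCell` (N-DEC shape between two DIFFERENT cells),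
  `CertifiedChain`, the proved composition `chain_compose` / `blockIRVia_of_chain`, load tubes `TubeCell`.
* §2 (card `constrained-fluctuation-criterion`; v3 RE-TYPED, ENGINE WITHDRAWN)  `skeletonEdges`, `ConstrainedTVCondOn adm`
  (8895's finite-size hypothesis for the CONSTRAINED system on an explicit admissible class of frozen data; agreement on ALL
  window-cell edges — triage r1-1 #14.1 fixed), its sup form `ConstrainedTVCondAt` (triage r1-2 O1: false at weak coupling),
  the v2 record `ConstrainedTVCondAtV2`, bookkeeping `constrainedTVCondOn_mono` / `constrainedTVCondAt_of_v2`,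
  `FiniteTorusEnclosure`, `EngineWilson` (strong-coupling regime only).
* §3 (card `weighted-load-lyapunov`)  `Height`, `DecimationContracts`, the proved `certifiedChain_of_contracts`,
  `HeightCalibratesDoor`.
* §4 (g2, card `decimation-cell-chain` v3 — THE MEETING INEQUALITY DISCHARGED BY `le_rfl`)  the typed Track-A ↔ chain
  interface `GibbsFormInCell F β₀ C` (H-b at an ARBITRARY cell; `gibbsFormInCell_door_iff` = the tree's `GibbsFormAtDoor` at the
  door cell), the depth-`M` transport node `ObservableTransportUAt b M A m` (`observableTransportUAt_zero_iff` = the tree's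
  `ObservableTransportU` at depth 0), and the PROVED kernel compositions `handOverU_of_chain`,
  `gapInUnits_su2_of_chain … := gapInUnits_of_fronts … (handOverU_of_chain …) le_rfl hD` (THE NUMBER is the chain length `M`,
  no `hmeet : β_exit ≤ 1/6`), `osDataWithGap_su2_of_chain` (SU(2) Clay-body instance via the tree's `osDataWithGap_of_legs`) and
  `gapInUnits_su2_of_split'` (depth 0 recovers the tree's window theorem verbatim).
* §5 (g2, card `loop-equation-certificate`)  THE EXACT AXIAL LOOP IDENTITY, PROVED: `lineHolonomy_axial_link`,
  `rectangleHolonomy_axial_link`, `wilsonLoop_axial_link` (configuration level), `map_perturbedMeasure_of_isCrossoverImage`,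
  `loopExp_crossover` (expectation level: the image's loop expectations ARE the `b`-dilated loop expectations of the pre-image);
  REQUESTS `DilatedLoopWindows` (E2′, instrument: certified windows robust over a cell) and `SDEnclosure` (analytic: SD equations
  linear in the couplings ⇒ sharp tube from windows + coarse tube); PROVED step composition `cellDecimatesToCell_of_loopData`.
  Last farm check: rc 0, 0 sorry.
-/

noncomputable section

open MeasureTheory Finset Function Metric Filter Topology
open scoped Matrix.Norms.Frobenius
open Literature.Probability.LatticeModels Literature.Probability.LatticeModels.DobrushinMetric
open Literature.MathematicalPhysics.QuantumLattice hiding torusNorm configShift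
open Literature.MathematicalPhysics.QuantumFieldTheory hiding ZdEdge
open Summit.Ventures.YMGap.RobustBall
open Summit.Ventures.YMGap.YM4Door Summit.Ventures.YMGap.YM4Door.SU2
open Summit.QuantumFields.YangMills.Cruxes.IR.Tempered (cellEdges windowCells regionEdges)
open Summit.QuantumFields.YangMills.Cruxes.OSLegsAtWeakCouplingC (Y2Bridge.UV Y2Bridge.NT Y2Bridge.ROT Y2Bridge.osDataWithGap_of_legs)

namespace Summit.QuantumFields.YangMills.Cruxes.IR.CruxIdea6Chain

/-! ## §1  Cells, one certified decimation step between two cells, finite chains, and their kernel composition -/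

/-- A CELL: a predicate of block-scale `SU(2)` actions in Bałaban format, per block-torus size. -/
abbrev Cell : Type := ∀ (S' : ℕ) [NeZero S'], BalabanEffectiveAction 4 S' (SUN 2) 1 → Prop

/-- **One certified step `C ↝ C'` at factor `b`** (N-DEC shape with two different cells): every action in `C` on a torus
`b·S'`, `S' ≥ 3`, has an axial crossover image in `C'` on `S'` — VOLUME-UNIFORMLY. -/
def CellDecimatesToCell (b : ℕ) [NeZero b] (C C' : Cell) : Prop :=
  ∀ (S' : ℕ) [NeZero S'], 3 ≤ S' → ∀ x : BalabanEffectiveAction 4 (b * S') (SUN 2) 1, C (b * S') x →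
    ∃ y : BalabanEffectiveAction 4 S' (SUN 2) 1, IsCrossoverImage (GaugeBlockAveraging.axial b S') x y ∧ C' S' y

/-- **A certified chain of `M` steps** through the cells `C 0 ↝ C 1 ↝ … ↝ C M`. -/
def CertifiedChain (b : ℕ) [NeZero b] (M : ℕ) (C : ℕ → Cell) : Prop :=
  ∀ k, k < M → CellDecimatesToCell b (C k) (C (k + 1))

/-- **Chain composition (kernel bookkeeping, proved):** a Gibbs form via `Φ` in cell `C j` on the torus `b^K·S` is carried by
`K` certified steps to a Gibbs form via `axialIter b S K ∘ Φ` in cell `C (j + K)` on `S`. -/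
theorem chain_compose {b : ℕ} [NeZero b] {M : ℕ} {C : ℕ → Cell} (hch : CertifiedChain b M C)
    {S : ℕ} [NeZero S] (hS : 3 ≤ S) {n : ℕ} [NeZero n] (β : ℝ) :
    ∀ (K j : ℕ), j + K ≤ M →
      ∀ (Φ : GaugeConfig 4 n (SUN 2) → GaugeConfig 4 (iterSize b S K) (SUN 2)), Measurable Φ →
        ∀ x : BalabanEffectiveAction 4 (iterSize b S K) (SUN 2) 1, GibbsFormVia Φ β x → C j (iterSize b S K) x →
          ∃ y : BalabanEffectiveAction 4 S (SUN 2) 1, GibbsFormVia (axialIter b S K ∘ Φ) β y ∧ C (j + K) S y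
  | 0, _, _, _, _, x, hx, hCx => ⟨x, hx, hCx⟩
  | K + 1, j, hjK, Φ, hΦ, x, hx, hCx => by
      obtain ⟨y₁, hy₁, hCy₁⟩ := hch j (by omega) (iterSize b S K) (hS.trans (le_iterSize b S K)) x hCx
      obtain ⟨y, hy, hCy⟩ := chain_compose hch hS β K (j + 1) (by omega)
        ((GaugeBlockAveraging.axial b (iterSize b S K)).link ∘ Φ)
        ((GaugeBlockAveraging.axial b (iterSize b S K)).measurable_link.comp hΦ) y₁
        (hx.comp hΦ (GaugeBlockAveraging.axial b (iterSize b S K)) hy₁) hCy₁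
      refine ⟨y, hy, ?_⟩
      rw [Nat.add_right_comm] at hCy
      exact hCy

/-- **What a certified chain buys (proved):** if the terminal cell clusters at `(A, m)` on every volume `≥ 3`, a Gibbs
form in the initial cell at depth `M` above `S` gives block-level IR via `axialIter b S M ∘ Φ` on `S`. -/
theorem blockIRVia_of_chain {b : ℕ} [NeZero b] {M : ℕ} {C : ℕ → Cell} (hch : CertifiedChain b M C) {A m : ℝ}
    (hcl : ∀ (S' : ℕ) [NeZero S'], 3 ≤ S' → ∀ y : BalabanEffectiveAction 4 S' (SUN 2) 1, C M S' y →
      ClustersWith y.terms y.β A m)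
    {S : ℕ} [NeZero S] (hS : 3 ≤ S) {n : ℕ} [NeZero n] (β : ℝ)
    (Φ : GaugeConfig 4 n (SUN 2) → GaugeConfig 4 (iterSize b S M) (SUN 2)) (hΦ : Measurable Φ)
    (x : BalabanEffectiveAction 4 (iterSize b S M) (SUN 2) 1) (hx : GibbsFormVia Φ β x) (hCx : C 0 (iterSize b S M) x) :
    BlockIRVia (axialIter b S M ∘ Φ) β A m := by
  obtain ⟨y, hy, hCy⟩ := chain_compose hch hS β M 0 (by omega) Φ hΦ x hx hCx
  exact hy.blockIRVia (hcl S hS y (by simpa using hCy))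

/-- **The terminal cell of the bridge = the tree's certified door** `(1/6; 11/500, 11/1000)` (`β_W,eff ≤ 1/3`). -/
def doorAsCell (κ : ℝ) : Cell := fun _ _ y => AtDoorCell y κ (1 / 6) (11 / 500) (11 / 1000)

/-- The door cell clusters at the tree constants (tree rows, hypothesis-free). -/
theorem clusters_of_doorAsCell (κ : ℝ) (S' : ℕ) [NeZero S'] (hS' : 3 ≤ S') (y : BalabanEffectiveAction 4 S' (SUN 2) 1)
    (hy : doorAsCell κ S' y) : ClustersWith y.terms y.β (16 * Real.exp (1 / 50)) (1 / 100) :=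
  clustersWith_of_atDoorCell hS' doorCell_oneThird y hy

/-- **A LOAD TUBE** — the cell format a certificate can produce: effective coupling in the interval `I`, terms within
`(ε₀, ε₁)` of a REFERENCE table `ref S'` in the `κ`-weighted load ball (the reference is the computed non-Wilson part of the
trajectory, replicated on every volume; `ref ≡ wilsonAt` recovers `AtDoorCell`-type cells). -/
def TubeCell (I : Set ℝ) (ref : ∀ (S' : ℕ) [NeZero S'], BalabanEffectiveAction 4 S' (SUN 2) 1) (κ ε₀ ε₁ : ℝ) : Cell :=
  fun S' _ x => x.β ∈ I ∧ 1 / 100 ≤ κ ∧ ∃ V : Perturbation 4 S' 2, x.terms = (ref S').terms + V ∧ InBall κ ε₀ ε₁ V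

/-- The bare Wilson action at tree coupling `β` as a one-point cell (start of a BARE chain: the MCRG setting). -/
def WilsonCell (β : ℝ) : Cell := fun _ _ x => x = BalabanEffectiveAction.wilsonAt β

/-- **REQUEST (card 1's crux shape) — A CERTIFIED CHAIN TO THE DOOR from the cell `C₀` in `M` steps of factor `b`.** -/
def ChainToDoor (b : ℕ) [NeZero b] (M : ℕ) (C₀ : Cell) (κ : ℝ) : Prop :=
  ∃ C : ℕ → Cell, C 0 = C₀ ∧ CertifiedChain b M C ∧
    ∀ (S' : ℕ) [NeZero S'], ∀ y : BalabanEffectiveAction 4 S' (SUN 2) 1, C M S' y → doorAsCell κ S' y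

/-- A chain to the door delivers block-level IR at the tree constants, `M` decimations below the initial cell (proved). -/
theorem blockIRVia_of_chainToDoor {b : ℕ} [NeZero b] {M : ℕ} {C₀ : Cell} {κ : ℝ} (h : ChainToDoor b M C₀ κ)
    {S : ℕ} [NeZero S] (hS : 3 ≤ S) {n : ℕ} [NeZero n] (β : ℝ)
    (Φ : GaugeConfig 4 n (SUN 2) → GaugeConfig 4 (iterSize b S M) (SUN 2)) (hΦ : Measurable Φ)
    (x : BalabanEffectiveAction 4 (iterSize b S M) (SUN 2) 1) (hx : GibbsFormVia Φ β x) (hCx : C₀ (iterSize b S M) x) :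
    BlockIRVia (axialIter b S M ∘ Φ) β (16 * Real.exp (1 / 50)) (1 / 100) := by
  obtain ⟨C, hC0, hch, hdoor⟩ := h
  subst hC0
  exact blockIRVia_of_chain hch (fun S' _ hS' y hy => clusters_of_doorAsCell κ S' hS' y (hdoor S' y hy)) hS β Φ hΦ x hx hCx

/-- **BARE-chain corollary (the MCRG / instrument setting, proved bookkeeping):** a chain to the door from the bare Wilson
cell at tree coupling `β` ⇒ the bare `SU(2)` law of the torus `b^M·S` decimated `M` times clusters at block level on every
`S ≥ 3` — a lattice mass-gap statement at ONE bare coupling in the crossover, which is NOT a known theorem for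
`β_W = 2β ∈ [1, 3]` (tree coupling `β = β_W/2`, RobustBall UNITS). -/
theorem blockIRVia_bare_of_chainToDoor {b : ℕ} [NeZero b] {M : ℕ} {β κ : ℝ} (h : ChainToDoor b M (WilsonCell β) κ)
    {S : ℕ} [NeZero S] (hS : 3 ≤ S) :
    BlockIRVia (axialIter b S M) β (16 * Real.exp (1 / 50)) (1 / 100) :=
  blockIRVia_of_chainToDoor h hS β id measurable_id (BalabanEffectiveAction.wilsonAt β) (gibbsFormVia_id_wilsonAt β) rfl

/-! ## §2  The per-step ENGINE (card `constrained-fluctuation-criterion`) — v3 RE-TYPED after triage r1 (seat 1 #14.1, seat 2 O1); ENGINE WITHDRAWN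

v2's `ConstrainedTVCondAt` (kept verbatim below as `ConstrainedTVCondAtV2`) required the two data `σ, σ'` to agree ONLY on
the window's skeleton, so they could differ on free links ADJACENT to `Y` — that moves the centre-cell kernel by
`O(min(β,1)) ≫ 1/M(1) = 5.6·10⁻⁴` at every coupling (triage r1-1 #14.1 «mis-transplanted»: 8895's `TVCondAt` lets `η, η'`
differ only OUTSIDE the window).  v3 restores 8895's agreement clause (every edge of every window cell) and makes the class
of admissible frozen data EXPLICIT (`adm`), because triage r1-2 O1 locates the SUBSTANTIVE failure of the sup form: a frozen
CENTRAL FULLY-FRUSTRATED skeleton `s(X,μ) = (−1)^{Σ_{ν<μ} X_ν}` orders the free links at weak coupling (frustration-induced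
axis field, global `SO(3)` breaking in `d = 4`; the printed decimation pathology, van Enter–Fernández–Sokal 1993 §4.1.2/§4.3.2),
so with `adm := ⊤` the condition is FALSE for small `ε` on the whole perturbative segment (`β_W,eff ≳ 3`) and at risk through
the upper crossover.  The only regimes in which a constrained-kernel engine can be typed honestly are (i) STRONG coupling, all
data (single-link Haar oscillation — provable LIKE, not BY, `Tempered.tv_strong_coupling_all`, whose edge set is the
unconstrained one: triage r1-2 O3), and (ii) typical ∕ annealed skeleton classes — which is line L-A's annealing device, not
this card's.  THE ENGINE IS WITHDRAWN for the crossover and the perturbative segment (desk `CROSSOVER-CENSUS.md`, g3); the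
definitions below are the typed RECORD of what was tried, plus two lines of bookkeeping. -/

section Constrained

variable {G : Type} [Group G] [TopologicalSpace G] [IsTopologicalGroup G] [CompactSpace G]
  [MeasurableSpace G] [BorelSpace G]

open Classical in
/-- The SKELETON of the regular mesh-`b` frame inside an edge set: edges lying on block-lattice lines (all transverse
coordinates divisible by `b`) — the straight transporters the axial decimation freezes. -/
def skeletonEdges (b : ℕ) (E : Finset (Literature.MathematicalPhysics.QuantumLattice.ZdEdge 4)) :
    Finset (Literature.MathematicalPhysics.QuantumLattice.ZdEdge 4) :=
  E.filter fun e => ∀ ν : Fin 4, ν ≠ e.2 → (b : ℤ) ∣ e.1 ν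

/-- The regular mesh-`b` frame. -/
def regularFrame (b : ℕ) : Fin 4 → ℤ → ℤ := fun _ j => (b : ℤ) * j

/-- **v2 (MIS-TYPED, kept for the record):** agreement of `σ, σ'` on the window's SKELETON only — false at every coupling
(triage r1-1 #14.1); superseded by `ConstrainedTVCondOn` / `ConstrainedTVCondAt` below. -/
def ConstrainedTVCondAtV2 {N : ℕ} (ρ : G →* Matrix (Fin N) (Fin N) ℂ) (β : ℝ) (b n : ℕ) (ε : ℝ) : Prop :=
  ∀ Y : Finset (Fin 4 → ℤ), Y ⊆ windowCells n → (0 : Fin 4 → ℤ) ∈ Y →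
    ∀ σ σ' : LGConfig 4 G,
      (∀ e ∈ skeletonEdges b (regionEdges (regularFrame b) (windowCells n)), σ e = σ' e) →
      ∀ f : LGConfig 4 G → ℝ, IsCylinder f (cellEdges (regularFrame b) 0) → Measurable f → (∀ U, 0 ≤ f U ∧ f U ≤ 1) →
        |(∫ U, f U ∂(ymSpecification ρ β
              (regionEdges (regularFrame b) Y \ skeletonEdges b (regionEdges (regularFrame b) Y)) σ)) -
          ∫ U, f U ∂(ymSpecification ρ β
              (regionEdges (regularFrame b) Y \ skeletonEdges b (regionEdges (regularFrame b) Y)) σ')| ≤ ε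

/-- **v3: CONSTRAINED finite-size mixing at `(ρ, β, b, n, ε)` on an ADMISSIBLE CLASS `adm` of frozen data** — 8895's
`TVCondAt` for the constrained system of ONE axial decimation step: for every sub-region `Y ∋ 0` of the window of
`(4n+1)^4` cells and any two admissible data `σ, σ'` that AGREE ON EVERY EDGE OF EVERY WINDOW CELL (hence on the window's
skeleton and on all its free links — they differ only OUTSIDE the window, exactly as in 8895), the Wilson kernel on the FREE
edges of `Y` (skeleton removed), read on `[0,1]`-valued cylinder observables of the centre cell, moves by `≤ ε`.
`adm := fun _ => True` is the sup form (`ConstrainedTVCondAt`; O1: FALSE for small `ε` at `β_W,eff ≳ 3`); a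
typical-skeleton class is L-A's annealing device; at strong coupling the sup form holds by single-link oscillation. -/
def ConstrainedTVCondOn {N : ℕ} (adm : LGConfig 4 G → Prop) (ρ : G →* Matrix (Fin N) (Fin N) ℂ) (β : ℝ) (b n : ℕ)
    (ε : ℝ) : Prop :=
  ∀ Y : Finset (Fin 4 → ℤ), Y ⊆ windowCells n → (0 : Fin 4 → ℤ) ∈ Y →
    ∀ σ σ' : LGConfig 4 G, adm σ → adm σ' →
      (∀ e ∈ regionEdges (regularFrame b) (windowCells n), σ e = σ' e) →
      ∀ f : LGConfig 4 G → ℝ, IsCylinder f (cellEdges (regularFrame b) 0) → Measurable f → (∀ U, 0 ≤ f U ∧ f U ≤ 1) →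
        |(∫ U, f U ∂(ymSpecification ρ β
              (regionEdges (regularFrame b) Y \ skeletonEdges b (regionEdges (regularFrame b) Y)) σ)) -
          ∫ U, f U ∂(ymSpecification ρ β
              (regionEdges (regularFrame b) Y \ skeletonEdges b (regionEdges (regularFrame b) Y)) σ')| ≤ ε

/-- **v3 sup form** (every frozen datum admissible). -/
def ConstrainedTVCondAt {N : ℕ} (ρ : G →* Matrix (Fin N) (Fin N) ℂ) (β : ℝ) (b n : ℕ) (ε : ℝ) : Prop :=
  ConstrainedTVCondOn (fun _ => True) ρ β b n ε

/-- Bookkeeping: the condition is ANTITONE in the admissible class and MONOTONE in `ε` (restricting the skeleton class —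
L-A's move — can only help; it is the sup form that O1 kills). -/
theorem constrainedTVCondOn_mono {N : ℕ} {adm adm' : LGConfig 4 G → Prop} (h : ∀ σ, adm σ → adm' σ)
    {ρ : G →* Matrix (Fin N) (Fin N) ℂ} {β : ℝ} {b n : ℕ} {ε ε' : ℝ} (hε : ε ≤ ε')
    (H : ConstrainedTVCondOn adm' ρ β b n ε) : ConstrainedTVCondOn adm ρ β b n ε' := by
  unfold ConstrainedTVCondOn at H ⊢
  intro Y hY h0 σ σ' hσ hσ' hag f hf hmf hf01
  exact (H Y hY h0 σ σ' (h σ hσ) (h σ' hσ') hag f hf hmf hf01).trans hε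

/-- Bookkeeping: the mis-typed v2 form (agreement on FEWER edges) implies the v3 sup form — so every v2-based composition of
the desk (`EngineWilson`) survives the re-typing with a WEAKER, correctly typed hypothesis. -/
theorem constrainedTVCondAt_of_v2 {N : ℕ} {ρ : G →* Matrix (Fin N) (Fin N) ℂ} {β : ℝ} {b n : ℕ} {ε : ℝ}
    (H : ConstrainedTVCondAtV2 ρ β b n ε) : ConstrainedTVCondAt ρ β b n ε := by
  unfold ConstrainedTVCondAt ConstrainedTVCondOn
  unfold ConstrainedTVCondAtV2 at H
  intro Y hY h0 σ σ' _ _ hag f hf hmf hf01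
  refine H Y hY h0 σ σ' (fun e he => hag e ?_) f hf hmf hf01
  unfold skeletonEdges at he
  exact (Finset.mem_filter.mp he).1

end Constrained

/-- **FINITE-TORUS ENCLOSURE `C ↝ C'` on ONE torus `b·S₀ → S₀`** — the part of a step a certified computation can deliver
(finite-dimensional: interval enclosure of the decimated local terms on the window torus).  Instrument fork A-0826-32 (β)
«one-2⁴-block conditional object with Cauchy-disc remainder, UNCONDITIONAL» is the smallest instance of this shape. -/
def FiniteTorusEnclosure (b S₀ : ℕ) [NeZero b] [NeZero S₀] (C C' : Cell) : Prop :=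
  ∀ x : BalabanEffectiveAction 4 (b * S₀) (SUN 2) 1, C (b * S₀) x →
    ∃ y : BalabanEffectiveAction 4 S₀ (SUN 2) 1, IsCrossoverImage (GaugeBlockAveraging.axial b S₀) x y ∧ C' S₀ y

/-- **REQUEST (card 2's crux shape, bare first step) — THE ENGINE for the Wilson cell, v3: STRONG-COUPLING REGIME ONLY**
(the one surviving rung R1 «door one level up», bare `β_W ∈ [1/3, 1/2]`; withdrawn in the crossover and above — O1 and
desk `CROSSOVER-CENSUS.md`): constrained finite-size mixing at `(β_fine = β, b, n, ε)` (v3 sup form) with 8895's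
admissibility `ε·M(n) < 1`, plus a finite-torus enclosure of the decimated Wilson action into the load tube
`(I; ref; κ, ε₀, ε₁)` on the window torus `S₀ = 2n+3`, give the VOLUME-UNIFORM step into the tube widened by the tail `τ`
(the crux includes the formula `τ = τ(n, ε, κ)`; here a parameter).  Wilson-action normalisation: `ymSpecification` and the
torus `wilsonAction` share the un-normalised trace convention, so the specification takes the SAME tree coupling `β`
(`SU(2)`: `β = β_W/2`, RobustBall/Defs UNITS). -/
def EngineWilson (β : ℝ) (b n : ℕ) [NeZero b] (ε τ : ℝ) (I : Set ℝ)
    (ref : ∀ (S' : ℕ) [NeZero S'], BalabanEffectiveAction 4 S' (SUN 2) 1) (κ ε₀ ε₁ : ℝ) : Prop :=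
  ConstrainedTVCondAt (G := SUN 2) SU2.ρ2 β b n ε →
    ε * ((((4 * n + 3) ^ 4 - (4 * n + 1) ^ 4 : ℕ)) : ℝ) < 1 →
      FiniteTorusEnclosure b (2 * n + 3) (WilsonCell β) (TubeCell I ref κ ε₀ ε₁) →
        CellDecimatesToCell b (WilsonCell β) (TubeCell I ref κ (ε₀ + τ) (ε₁ + τ))

/-! ## §3  A LYAPUNOV HEIGHT for decimation (card `weighted-load-lyapunov`) -/

/-- A HEIGHT on block-scale actions, per volume (intended instance: the `κ`-weighted sup load of the non-Wilson terms plus a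
weight times the effective coupling — an interface; its CONSTRUCTION with the two properties below is the crux). -/
abbrev Height : Type := ∀ (S' : ℕ) [NeZero S'], BalabanEffectiveAction 4 S' (SUN 2) 1 → ℝ

/-- **Decimation CONTRACTS the height by `θ` on the tube `T`** (and keeps the tube): one certified inequality per step
instead of one certified cell per step. -/
def DecimationContracts (b : ℕ) [NeZero b] (T : Cell) (V : Height) (θ : ℝ) : Prop :=
  ∀ (S' : ℕ) [NeZero S'], 3 ≤ S' → ∀ x : BalabanEffectiveAction 4 (b * S') (SUN 2) 1, T (b * S') x →
    ∃ y : BalabanEffectiveAction 4 S' (SUN 2) 1,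
      IsCrossoverImage (GaugeBlockAveraging.axial b S') x y ∧ T S' y ∧ V S' y ≤ θ * V (b * S') x

/-- **The height CALIBRATES the door:** inside the tube, height `≤ v` means membership in the tree door cell. -/
def HeightCalibratesDoor (T : Cell) (V : Height) (v κ : ℝ) : Prop :=
  ∀ (S' : ℕ) [NeZero S'], ∀ y : BalabanEffectiveAction 4 S' (SUN 2) 1, T S' y → V S' y ≤ v → doorAsCell κ S' y

/-- **A contraction IS a certified chain (proved):** the sub-level cells `{T ∧ V ≤ θ^k·V₀}` form a certified chain of every
length. -/
theorem certifiedChain_of_contracts {b : ℕ} [NeZero b] {T : Cell} {V : Height} {θ : ℝ} (hθ : 0 ≤ θ)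
    (h : DecimationContracts b T V θ) (M : ℕ) (V₀ : ℝ) :
    CertifiedChain b M (fun k S' _ x => T S' x ∧ V S' x ≤ θ ^ k * V₀) := by
  intro k _ S' _ hS' x hx
  obtain ⟨hT, hV⟩ := hx
  obtain ⟨y, hy, hTy, hVy⟩ := h S' hS' x hT
  refine ⟨y, hy, hTy, hVy.trans ?_⟩
  calc θ * V (b * S') x ≤ θ * (θ ^ k * V₀) := mul_le_mul_of_nonneg_left hV hθ
    _ = θ ^ (k + 1) * V₀ := by ring

/-- **… hence a contraction calibrating the door is a chain to the door of length `M` as soon as `θ^M·V₀ ≤ v` (proved):**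
`M = ⌈log(V₀/v) / log(1/θ)⌉` steps — THE NUMBER OF STEPS of the bridge in this card's currency. -/
theorem chainToDoor_of_contracts {b : ℕ} [NeZero b] {T : Cell} {V : Height} {θ v κ V₀ : ℝ} (hθ : 0 ≤ θ)
    (h : DecimationContracts b T V θ) (hcal : HeightCalibratesDoor T V v κ) {M : ℕ} (hM : θ ^ M * V₀ ≤ v) :
    ChainToDoor b M (fun S' _ x => T S' x ∧ V S' x ≤ θ ^ 0 * V₀) κ :=
  ⟨fun k S' _ x => T S' x ∧ V S' x ≤ θ ^ k * V₀, rfl, certifiedChain_of_contracts hθ h M V₀,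
    fun S' _ y hy => hcal S' y hy.1 (hy.2.trans hM)⟩


/-! ## §4 (g2, 2026-08-26)  THE MEETING INEQUALITY DISCHARGED BY `le_rfl`

The tree's window theorem `Y2Bridge.Window.gapInUnits_of_fronts (hWC) (hHO : HandOverU F r β₀ m) (hmeet : β_exit ≤ β₀) (hD)`
asks the weak-coupling front (exit `β_exit`) and the β-uniform hand-over (door `β₀`) to MEET.  §1's certified chain moves the
hand-over UP to the exit: a Track-A exit cell `C_exit` in Gibbs form at `β_exit` (`GibbsFormInCell`, H-b addressed to an
arbitrary cell — the INTERFACE between Track A and the chain), a chain `ChainToDoor b M C_exit κ`, and the uniform observable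
transport at depth `M` (`ObservableTransportUAt`, node U-OBS re-addressed to the composite link map `axialIter b S M ∘ B.link`,
exactly as `DecimationFlow` §5 re-addressed N-NP to a bare link map; at depth `0` it IS the tree's `ObservableTransportU`)
give `HandOverU F r β_exit (m / b^M)` — so `gapInUnits_of_fronts` applies with `hmeet := le_rfl`.  THE NUMBER becomes `M`.
Depth `0` recovers the tree's `gapInUnits_su2_of_split` verbatim (`gapInUnits_su2_of_split'`).  Bookkeeping only; 0 sorry. -/

section Window

open Literature.MathematicalPhysics.QuantumFieldTheory.Balaban1983to89.CrossoverLedger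
open Summit.QuantumFields.YangMills.Cruxes.OSLegsFromFemtoAndGap.DlrCollarTransfer
open Summit.QuantumFields.YangMills.Cruxes.OSLegsAtWeakCouplingC.Y2Bridge.Window
open Summit.QuantumFields.YangMills.Cruxes.OSLegsAtWeakCouplingC.Y2Bridge.Window.SU2

/-- The strip cell of Track A's exit currency (`NearInStrip`, Crossover.lean §3): coupling within `ηc` of a reference table and
terms within analytic norm `η` of it on the strip of half-width `r` — the format N-CVg / N-NP speak. -/
def StripCell (ref : ∀ (S' : ℕ) [NeZero S'], BalabanEffectiveAction 4 S' (SUN 2) 1) (ηc r κ η : ℝ) : Cell :=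
  fun S' _ x => NearInStrip x (ref S') ηc r κ η

/-- **INTERFACE (H-b addressed to a cell `C`): the flow's Gibbs form lies in `C` at every controlled step with effective
coupling `≤ β₀`**, on every block torus `S ≥ 3` (blocking factor `F.L^k`).  With `C = doorAsCell κ` this is the tree's
`GibbsFormAtDoor F β₀ κ` (`gibbsFormInCell_door_iff`); with `C = StripCell …` and `β₀ = β_exit` it is what Track A's exit must
hand to the chain. -/
def GibbsFormInCell (F : RGFlowControl) (β₀ : ℝ) (C : Cell) : Prop :=
  ∀ (β : ℝ) (k : ℕ), F.Controlled β k → F.betaEff β k ≤ β₀ →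
    ∀ (c : ℕ) [NeZero c], c = F.L ^ k → ∀ (S : ℕ) [NeZero S], 3 ≤ S →
      ∃ (B : GaugeBlockAveraging 4 (SUN 2) c S) (x : BalabanEffectiveAction 4 S (SUN 2) 1),
        GibbsFormVia B.link β x ∧ C S x

/-- At the door cell the interface IS the tree's H-b (definitional). -/
theorem gibbsFormInCell_door_iff (F : RGFlowControl) (β₀ κ : ℝ) :
    GibbsFormInCell F β₀ (doorAsCell κ) ↔ GibbsFormAtDoor F β₀ κ := Iff.rfl

/-- The interface is antitone in the threshold. -/
theorem GibbsFormInCell.anti {F : RGFlowControl} {β₀ β₀' : ℝ} {C : Cell} (h : GibbsFormInCell F β₀ C) (hle : β₀' ≤ β₀) :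
    GibbsFormInCell F β₀' C :=
  fun β k hc hb => h β k hc (hb.trans hle)

/-- **Node U-OBS at depth `M` (OPEN; hypothesis schema)**: the β- and blocking-uniform observable transport of
`Y2BridgeWindow.ObservableTransportU`, asked of the COMPOSITE link maps `axialIter b S M ∘ B.link` (a tree blocking of factor
`c` followed by `M` axial decimations): block-level IR at `(A, m)` on every block torus `S ≥ 3` ⇒ every pair of gauge-invariant
species clusters on the fine tori of side `≥ 2 S₁(β, c) + 1` at lattice rate `m / (c·b^M)`, constants depending on the species
only.  At `M = 0` this is `ObservableTransportU` (`observableTransportUAt_zero_iff`). -/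
def ObservableTransportUAt (b : ℕ) [NeZero b] (M : ℕ) (A m : ℝ) : Prop :=
  ∃ S₁ : ℝ → ℕ → ℕ, ∀ (P Q : YMSpecies (SUN 2)), ∃ C : ℝ, ∀ (β : ℝ) (c : ℕ) [NeZero c],
    (∀ (S : ℕ) [NeZero S], 3 ≤ S →
      ∃ B : GaugeBlockAveraging 4 (SUN 2) c (iterSize b S M), BlockIRVia (axialIter b S M ∘ B.link) β A m) →
    ∀ S : ℕ, S₁ β c ≤ S → ∀ n : ℕ, n ≤ S →
      |latticeConnectedCorr (fundamentalLatticeRep 2).ρ β (2 * S + 1) P.F Q.F n| ≤ C * Real.exp (-(m / (c * (b : ℝ) ^ M) * n))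

/-- At depth `0` the node is the tree's `ObservableTransportU` (same binders; `axialIter b S 0 = id`, `b^0 = 1`). -/
theorem observableTransportUAt_zero_iff (b : ℕ) [NeZero b] (A m : ℝ) :
    ObservableTransportUAt b 0 A m ↔ ObservableTransportU A m := by
  unfold ObservableTransportUAt ObservableTransportU
  simp only [axialIter_zero, Function.id_comp, pow_zero, mul_one, iterSize_zero]
  rfl

/-- **GLUE (proved): exit cell in Gibbs form + certified chain to the door + transport at depth `M` ⇒ the β-UNIFORM HAND-OVER
AT THE EXIT THRESHOLD ITSELF**, rate `(1/100)/b^M`.  (Analogue of the tree's `handOverU_of_split`, whose door `1/6` is here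
replaced by the cell `C₀` sitting `M` certified decimations above the door.) -/
theorem handOverU_of_chain (F : RGFlowControl) {β₀ κ : ℝ} {b M : ℕ} [NeZero b] {C₀ : Cell}
    (hExit : GibbsFormInCell F β₀ C₀) (hchain : ChainToDoor b M C₀ κ)
    (hc : ObservableTransportUAt b M (16 * Real.exp (1 / 50)) (1 / 100)) :
    HandOverU F (fundamentalLatticeRep 2) β₀ (1 / 100 / (b : ℝ) ^ M) := by
  obtain ⟨S₁, hc⟩ := hc
  have hb : (0 : ℝ) < b := by exact_mod_cast Nat.pos_of_ne_zero (NeZero.ne b)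
  refine ⟨by positivity, fun β k => S₁ β (F.L ^ k), fun P Q => ?_⟩
  obtain ⟨C, hC⟩ := hc P Q
  refine ⟨C, fun β k hctrl hle S hS n hn => ?_⟩
  have hL0 : F.L ≠ 0 := by have := F.one_lt_L; omega
  haveI : NeZero (F.L ^ k) := ⟨pow_ne_zero _ hL0⟩
  have h := hC β (F.L ^ k) (fun S' _ hS3 => by
    obtain ⟨B, x, hx, hCx⟩ := hExit β k hctrl hle (F.L ^ k) rfl (iterSize b S' M) (hS3.trans (le_iterSize b S' M))
    exact ⟨B, blockIRVia_of_chainToDoor hchain hS3 β B.link B.measurable_link x hx hCx⟩) S hS n hn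
  have hrate : (1 : ℝ) / 100 / (b : ℝ) ^ M / (F.L : ℝ) ^ k = 1 / 100 / (((F.L ^ k : ℕ) : ℝ) * (b : ℝ) ^ M) := by
    push_cast; ring
  rw [hrate]
  exact h

/-- ★ **`IR ⇐ fronts` FOR SU(2) WITH THE MEETING INEQUALITY DISCHARGED BY `le_rfl`.**  A weak-coupling front controlled down to
`β_exit` with two-sided steps (Track A), its exit cell `C_exit` in Gibbs form at `β_exit` (the interface), a CERTIFIED CHAIN of
`M` decimation cells from `C_exit` to the tree door (THIS SEAT'S CRUX SHAPE, card `decimation-cell-chain`) and transport at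
depth `M` ⇒ the IR leg of the Clay bridge for `(SU(2), fundamental)` at the exit-scale unit map, rate `(1/100)/b^M` in those
units.  The tree theorem `gapInUnits_of_fronts` is invoked with `hmeet := le_rfl`: THE NUMBER is `M`. -/
theorem gapInUnits_su2_of_chain (F : RGFlowControl) {β_exit κ D : ℝ} {b M : ℕ} [NeZero b] {C_exit : Cell}
    (hWC : WeakCouplingFront F β_exit) (hD : BoundedDecrease F D)
    (hExit : GibbsFormInCell F β_exit C_exit) (hchain : ChainToDoor b M C_exit κ)
    (hc : ObservableTransportUAt b M (16 * Real.exp (1 / 50)) (1 / 100)) :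
    ∃ a : ℝ → ℝ, (∀ β, 0 < a β) ∧ Tendsto a atTop (𝓝 0) ∧ GapInUnits (SUN 2) (fundamentalLatticeRep 2) a ∧
      ∀ β, β_exit ≤ β → ∃ k : ℕ, a β = ((F.L : ℝ) ^ k)⁻¹ ∧ F.Controlled β k ∧ F.betaEff β k < β_exit ∧
        ∀ j < k, β_exit ≤ F.betaEff β j :=
  gapInUnits_of_fronts (fundamentalLatticeRep 2) hWC (handOverU_of_chain F hExit hchain hc) le_rfl hD

/-- … hence, with UV ∧ NT ∧ ROT for SU(2) at the same unit map (the spine's other legs), SU(2) OS data with both gaps — the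
`G = SU(2)` instance of the Clay conjunction's body, by the tree's `osDataWithGap_of_legs`. -/
theorem osDataWithGap_su2_of_chain (F : RGFlowControl) {β_exit κ D : ℝ} {b M : ℕ} [NeZero b] {C_exit : Cell}
    (hWC : WeakCouplingFront F β_exit) (hD : BoundedDecrease F D)
    (hExit : GibbsFormInCell F β_exit C_exit) (hchain : ChainToDoor b M C_exit κ)
    (hc : ObservableTransportUAt b M (16 * Real.exp (1 / 50)) (1 / 100))
    (hlegs : ∀ a : ℝ → ℝ, (∀ β, 0 < a β) → Tendsto a atTop (𝓝 0) →
      (∀ β, β_exit ≤ β → ∃ k : ℕ, a β = ((F.L : ℝ) ^ k)⁻¹ ∧ F.Controlled β k ∧ F.betaEff β k < β_exit ∧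
        ∀ j < k, β_exit ≤ F.betaEff β j) →
      Y2Bridge.UV (SUN 2) (fundamentalLatticeRep 2) a ∧ Y2Bridge.NT (SUN 2) (fundamentalLatticeRep 2) a ∧
        Y2Bridge.ROT (SUN 2) (fundamentalLatticeRep 2) a) :
    ∃ (a : ℝ → ℝ) (sch : SpeciesScheme (YMSpecies (SUN 2))) (T : OSData (YMSpecies (SUN 2)) 4),
      (∀ k, sch.a k = a (sch.β k)) ∧ sch.HasWeakCouplingLimit ∧ IsYangMillsFor (fundamentalLatticeRep 2) sch T ∧
        T.IsNontrivial (fundamentalLatticeRep 2).curvature ∧ T.IsNonGaussian (fundamentalLatticeRep 2).curvature ∧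
        ∃ Δ > 0, T.HasMassGap Δ ∧ HasLatticeMassGap (fundamentalLatticeRep 2) sch Δ := by
  obtain ⟨a, hapos, ha0, hIR, hexit⟩ := gapInUnits_su2_of_chain F hWC hD hExit hchain hc
  obtain ⟨hUV, hNT, hROT⟩ := hlegs a hapos ha0 hexit
  obtain ⟨sch, T, h⟩ := Y2Bridge.osDataWithGap_of_legs (fundamentalLatticeRep 2) a hapos ha0 hUV hNT hIR hROT
  exact ⟨a, sch, T, h⟩

/-- The chain of length `0` from the door cell (trivially certified). -/
theorem chainToDoor_zero (b : ℕ) [NeZero b] (κ : ℝ) : ChainToDoor b 0 (doorAsCell κ) κ :=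
  ⟨fun _ => doorAsCell κ, rfl, fun _ hk => absurd hk (Nat.not_lt_zero _), fun _ _ _ hy => hy⟩

/-- **Depth `0` = the tree's window theorem verbatim**: `gapInUnits_su2_of_split` re-derived from `gapInUnits_su2_of_chain`
with `M = 0`, `C_exit :=` the door cell (so `hmeet : β_exit ≤ 1/6` feeds `GibbsFormInCell.anti`).  Certifies that §4
GENERALISES the tree's window and changes nothing at depth `0`. -/
theorem gapInUnits_su2_of_split' (F : RGFlowControl) {β_exit κ D : ℝ} (hWC : WeakCouplingFront F β_exit)
    (hmeet : β_exit ≤ 1 / 6) (hb : GibbsFormAtDoor F (1 / 6) κ)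
    (hc : ObservableTransportU (16 * Real.exp (1 / 50)) (1 / 100)) (hD : BoundedDecrease F D) :
    ∃ a : ℝ → ℝ, (∀ β, 0 < a β) ∧ Tendsto a atTop (𝓝 0) ∧ GapInUnits (SUN 2) (fundamentalLatticeRep 2) a ∧
      ∀ β, β_exit ≤ β → ∃ k : ℕ, a β = ((F.L : ℝ) ^ k)⁻¹ ∧ F.Controlled β k ∧ F.betaEff β k < β_exit ∧
        ∀ j < k, β_exit ≤ F.betaEff β j :=
  gapInUnits_su2_of_chain (b := 1) (M := 0) F hWC hD (((gibbsFormInCell_door_iff F (1 / 6) κ).2 hb).anti hmeet)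
    (chainToDoor_zero 1 κ) ((observableTransportUAt_zero_iff 1 _ _).2 hc)

end Window


/-! ## §5 (g2, card `loop-equation-certificate`)  THE EXACT AXIAL LOOP IDENTITY and the LOOP-DATA CERTIFICATE of one chain step

The decimated measure is an EXACT push-forward, so every rectangular Wilson loop of the axially blocked field IS the `b`-dilated
loop of the fine field from the block representative (`wilsonLoop_axial_link`, configuration level, `rfl`-grade bookkeeping over
the tree's `lineHolonomy`/`transport` vocabularies) and — through a crossover image — loop EXPECTATIONS of consecutive chain
members agree exactly (`loopExp_crossover`).  Hence CERTIFIED TWO-SIDED WINDOWS on finitely many dilated-loop expectations,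
robust over the current cell (REQUEST `DilatedLoopWindows` = E2′, an INSTRUMENT product: SU(2) loop-equation SDP duals à la
Kazakov–Zheng, evaluated by interval arithmetic over the cell's tube), plus an a-priori COARSE image tube (E3, analytic) and the
SCHWINGER–DYSON ENCLOSURE (REQUEST `SDEnclosure`: the SD equations of the image are LINEAR in its couplings with coefficients =
those loop expectations [González-Arroyo–Okawa 1987]; interval elimination + tail slack) give the certified step INTO A SHARP TUBE
(`cellDecimatesToCell_of_loopData`, proved bookkeeping).  No fluctuation integral is computed anywhere in this format. -/

section LoopIdentity

open Literature.MathematicalPhysics.QuantumLattice (torusBlockCorner torusBlockCorner_shift transport transport_cons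
  transport_nil fundamentalRep continuous_fundamentalRep)
open Literature.MathematicalPhysics.QuantumFieldTheory.StringTension (measurable_wilsonLoop)

variable {d L : ℕ} {G : Type*} [Group G]

/-- A straight transporter IS a line holonomy (bookkeeping between the two tree vocabularies). -/
theorem transport_replicate_eq_lineHolonomy (U : GaugeConfig d L G) (k : Fin d) :
    ∀ (n : ℕ) (c : Site d L), transport U c (List.replicate n k) = lineHolonomy U k n c
  | 0, c => by simp
  | n + 1, c => by
      rw [List.replicate_succ, transport_cons, lineHolonomy_succ, transport_replicate_eq_lineHolonomy U k n]

variable {b S : ℕ} [NeZero b] [NeZero S]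

omit [NeZero b] in
/-- Block representatives along a coarse line: `corner (x + R·e_i) = corner x + (b·R)·e_i`. -/
theorem torusBlockCorner_add_natSingle (x : Site d S) (i : Fin d) :
    ∀ R : ℕ, torusBlockCorner b S (x + Pi.single i ((R : ℕ) : ZMod S)) =
      torusBlockCorner b S x + Pi.single i (((b * R : ℕ)) : ZMod (b * S))
  | 0 => by simp
  | R + 1 => by
      have h : x + Pi.single i (((R + 1 : ℕ)) : ZMod S) = (x + Pi.single i ((R : ℕ) : ZMod S)).shift i := by
        simp only [Literature.MathematicalPhysics.QuantumFieldTheory.Site.shift, add_assoc, ← Pi.single_add]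
        congr 2
        push_cast
        ring
      rw [h, torusBlockCorner_shift, torusBlockCorner_add_natSingle x i R, add_assoc, ← Pi.single_add]
      congr 2
      push_cast
      ring

omit [NeZero b] in
/-- **Lines.**  The line holonomy of the axially blocked `SU(2)` field is the `b`-times longer line holonomy of the fine field
from the block representative. -/
theorem lineHolonomy_axial_link (U : GaugeConfig 4 (b * S) (SUN 2)) (i : Fin 4) :
    ∀ (R : ℕ) (x : Site 4 S), lineHolonomy ((GaugeBlockAveraging.axial b S).link U) i R x =
      lineHolonomy U i (b * R) (torusBlockCorner b S x)
  | 0, x => by simp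
  | R + 1, x => by
      have hlink : (GaugeBlockAveraging.axial b S).link U (x, i) = lineHolonomy U i b (torusBlockCorner b S x) :=
        transport_replicate_eq_lineHolonomy U i b (torusBlockCorner b S x)
      rw [lineHolonomy_succ, hlink, lineHolonomy_axial_link U i R (x.shift i), torusBlockCorner_shift,
        show b * (R + 1) = b + b * R by ring, lineHolonomy_add]

omit [NeZero b] in
/-- **Rectangles — THE EXACT AXIAL LOOP IDENTITY (configuration level).** -/
theorem rectangleHolonomy_axial_link (U : GaugeConfig 4 (b * S) (SUN 2)) (x : Site 4 S) (i j : Fin 4) (R T : ℕ) :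
    rectangleHolonomy ((GaugeBlockAveraging.axial b S).link U) x i j R T =
      rectangleHolonomy U (torusBlockCorner b S x) i j (b * R) (b * T) := by
  simp only [rectangleHolonomy, lineHolonomy_axial_link, torusBlockCorner_add_natSingle]

omit [NeZero b] in
/-- **Wilson loops:** `W_{x;i,j;R,T}(axial_b U) = W_{b·x;i,j;bR,bT}(U)`. -/
theorem wilsonLoop_axial_link (U : GaugeConfig 4 (b * S) (SUN 2)) (x : Site 4 S) (i j : Fin 4) (R T : ℕ) :
    wilsonLoop SU2.ρ2 x i j R T ((GaugeBlockAveraging.axial b S).link U) =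
      wilsonLoop SU2.ρ2 (torusBlockCorner b S x) i j (b * R) (b * T) U := by
  simp only [wilsonLoop, rectangleHolonomy_axial_link]

omit [NeZero b] in
/-- The block representative of the origin is the origin. -/
theorem torusBlockCorner_zero : torusBlockCorner b S (0 : Site d S) = 0 := by
  have h := torusBlockCorner_add (M := b) (S := S) (0 : Site d S) 0
  rw [add_zero] at h
  exact left_eq_add.mp h

/-- A rectangular loop LABEL `(i, j, R, T)` (based at the origin; cells are translation invariant) and its `b`-dilation. -/
abbrev LoopLabel : Type := Fin 4 × Fin 4 × ℕ × ℕ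

/-- `b`-dilation of a loop label. -/
def dilate (b : ℕ) (l : LoopLabel) : LoopLabel := (l.1, l.2.1, b * l.2.2.1, b * l.2.2.2)

/-- The LOOP EXPECTATION of the Gibbs state of a Bałaban-format `SU(2)` action. -/
def loopExp {S' : ℕ} [NeZero S'] (y : BalabanEffectiveAction 4 S' (SUN 2) 1) (l : LoopLabel) : ℝ :=
  ∫ V, wilsonLoop SU2.ρ2 (0 : Site 4 S') l.1 l.2.1 l.2.2.1 l.2.2.2 V ∂(y.terms.perturbedMeasure SU2.ρ2 y.β)

/-- **A crossover image is an exact push-forward of the NORMALISED Gibbs states** (the tree's `IsCrossoverImage` is stated for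
the weights; block averaging loses no mass). -/
theorem map_perturbedMeasure_of_isCrossoverImage {x : BalabanEffectiveAction 4 (b * S) (SUN 2) 1}
    {y : BalabanEffectiveAction 4 S (SUN 2) 1} (h : IsCrossoverImage (GaugeBlockAveraging.axial b S) x y) :
    (x.terms.perturbedMeasure SU2.ρ2 x.β).map (GaugeBlockAveraging.axial b S).link = y.terms.perturbedMeasure SU2.ρ2 y.β := by
  have h' : ((torusLinkHaar 4 (SUN 2) (b * S)).withDensity (x.density SU2.ρ2)).map (GaugeBlockAveraging.axial b S).link =
      (torusLinkHaar 4 (SUN 2) S).withDensity (y.density SU2.ρ2) := (isCrossoverImageVia_link_iff _ x y).2 h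
  rw [BalabanEffectiveAction.density_eq_perturbedWilsonDensity, BalabanEffectiveAction.density_eq_perturbedWilsonDensity,
    withDensity_perturbedWilsonDensity_total, withDensity_perturbedWilsonDensity_total] at h'
  have hZ : y.terms.partitionFunction SU2.ρ2 y.β = x.terms.partitionFunction SU2.ρ2 x.β := by
    rw [QuasiLocalGaugePerturbation.partitionFunction, QuasiLocalGaugePerturbation.partitionFunction, ← h',
      Measure.map_apply (GaugeBlockAveraging.axial b S).measurable_link MeasurableSet.univ, Set.preimage_univ]
  rw [QuasiLocalGaugePerturbation.perturbedMeasure, QuasiLocalGaugePerturbation.perturbedMeasure, Measure.map_smul, h', hZ]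

/-- ★ **THE EXACT AXIAL LOOP IDENTITY (expectation level):** across one chain step the image's loop expectations ARE the
`b`-dilated loop expectations of the pre-image — no error term, every volume, every coupling. -/
theorem loopExp_crossover {x : BalabanEffectiveAction 4 (b * S) (SUN 2) 1} {y : BalabanEffectiveAction 4 S (SUN 2) 1}
    (h : IsCrossoverImage (GaugeBlockAveraging.axial b S) x y) (l : LoopLabel) : loopExp y l = loopExp x (dilate b l) := by
  unfold loopExp
  rw [← map_perturbedMeasure_of_isCrossoverImage h, integral_map (GaugeBlockAveraging.axial b S).measurable_link.aemeasurable
    (measurable_wilsonLoop SU2.ρ2 (continuous_fundamentalRep (n := Fin 2)) _ _ _ _ _).aestronglyMeasurable]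
  simp only [wilsonLoop_axial_link, torusBlockCorner_zero, dilate]

/-- **REQUEST E2′ (INSTRUMENT PRODUCT) — CERTIFIED LOOP WINDOWS ON THE `b`-DILATED MENU, ROBUST OVER THE CELL `C`**: every action of
`C` on every volume `b·S'`, `S' ≥ 3`, has its dilated-menu loop expectations in `[lo l, hi l]`.  Certificate format per `l ∈ Λ`:
two dual vectors of the truncated `SU(2)` loop-equation SDP (rational entries), whose bound is affine in the cell's couplings and
is evaluated by interval arithmetic over the tube. -/
def DilatedLoopWindows (b : ℕ) [NeZero b] (C : Cell) (Λ : Finset LoopLabel) (lo hi : LoopLabel → ℝ) : Prop :=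
  ∀ (S' : ℕ) [NeZero S'], 3 ≤ S' → ∀ x : BalabanEffectiveAction 4 (b * S') (SUN 2) 1, C (b * S') x →
    ∀ l ∈ Λ, loopExp x (dilate b l) ∈ Set.Icc (lo l) (hi l)

/-- **REQUEST (ANALYTIC, finite linear algebra with slack) — THE SCHWINGER–DYSON ENCLOSURE**: menu loop windows + the COARSE tube
`(I, ref, E₀, E₁)` enclose the action in the SHARP tube `(I', ref', ε₀, ε₁)` — on every volume `S' ≥ 3`.  Content: the SD
equations of `y` are linear in the couplings of `y` with coefficients the menu expectations; the coarse tube bounds the tail's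
contribution to each equation; interval elimination re-centres (`ref ↦ ref'`) and pins (`I ↦ I'`); the radius floor is the tail. -/
def SDEnclosure (Λ : Finset LoopLabel) (lo hi : LoopLabel → ℝ) (I I' : Set ℝ)
    (ref ref' : ∀ (S' : ℕ) [NeZero S'], BalabanEffectiveAction 4 S' (SUN 2) 1) (κ E₀ E₁ ε₀ ε₁ : ℝ) : Prop :=
  ∀ (S' : ℕ) [NeZero S'], 3 ≤ S' → ∀ y : BalabanEffectiveAction 4 S' (SUN 2) 1,
    (∀ l ∈ Λ, loopExp y l ∈ Set.Icc (lo l) (hi l)) → TubeCell I ref κ E₀ E₁ S' y → TubeCell I' ref' κ ε₀ ε₁ S' y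

/-- ★ **ONE CERTIFIED CHAIN STEP FROM LOOP DATA (proved bookkeeping).**  E3 (a-priori: SOME axial crossover image in the COARSE
tube) ∧ E2′ (certified windows on the dilated menu, robust over `C`) ∧ the SD enclosure ⇒ `C ↝ TubeCell I' ref' κ ε₀ ε₁`.
The exact identity `loopExp_crossover` converts the fine windows into windows of the image for free. -/
theorem cellDecimatesToCell_of_loopData {C : Cell} {Λ : Finset LoopLabel} {lo hi : LoopLabel → ℝ} {I I' : Set ℝ}
    {ref ref' : ∀ (S' : ℕ) [NeZero S'], BalabanEffectiveAction 4 S' (SUN 2) 1} {κ E₀ E₁ ε₀ ε₁ : ℝ}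
    (hE3 : CellDecimatesToCell b C (TubeCell I ref κ E₀ E₁)) (hE2 : DilatedLoopWindows b C Λ lo hi)
    (hSD : SDEnclosure Λ lo hi I I' ref ref' κ E₀ E₁ ε₀ ε₁) :
    CellDecimatesToCell b C (TubeCell I' ref' κ ε₀ ε₁) := by
  intro S' _ hS' x hx
  obtain ⟨y, hy, hyT⟩ := hE3 S' hS' x hx
  refine ⟨y, hy, hSD S' hS' y (fun l hl => ?_) hyT⟩
  rw [loopExp_crossover hy]
  exact hE2 S' hS' x hx l hl

end LoopIdentity

end Summit.QuantumFields.YangMills.Cruxes.IR.CruxIdea6Chain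

end
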